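import Summits.HodgeConjecture.CorCM.B01.Transposition.Item2HoldsConj
import HarnessLib

/-!
# Transposition item (ii), addendum 2: the reflex CM type does not see the conjugation of the base embedding

COR-CM (cell pub-hodgecm2), TRANSPOSITION dictionary item (ii) of rfwf v3 §4.2, writer of record `pub-hodgecm2-tr-prover-2`
(path family `Transposition/Item2Holds*.lean`, HOME/INBOX l. 3654 / l. 3752).  FRAMING (coordinator ruling 2026-08-21T11:55:35Z,
binding): `HC_CM` is NOT proved; this file proves finite Galois bookkeeping about CM types and nothing more.

Companion of `Item2HoldsConj.lean` (p300451): there, the inverse type `Θ^{*σ}`, the `isInverse` relation and the reflex FIELD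
`K*(σ, Θ) = reflexField ℚ F (algValuedIn σ Θ.1)` were shown not to change under `σ ↦ σ̄`.  Here the reflex CM TYPE:

* `reflexCMType_conjugate_left` — `reflexCMType σ̄ Θ φ` is `reflexCMType σ Θ φ` transported along the identification
  `K*(σ̄, Θ) = K*(σ, Θ)` (`IntermediateField.equivOfEq`, the pattern of the tree's `reflexCMType_bar`).  Proof, for
  `g ∈ Gal(F/ℚ)`: `σ̄ ∘ g|_{K*} ∈ Θ*_{σ̄} ↔ g ∈ S*(Θ_{σ̄}) = S*(Θ̄_σ) = ρ • S*(Θ_σ) ↔ ρ g ∈ S*(Θ_σ) ↔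
  σ ∘ (ρ g)|_{K*} = conj ∘ (σ ∘ g|_{K*}) = σ̄ ∘ g|_{K*} ∈ Θ*_σ` (tree `reflexLift_algValuedIn_bar_eq_smul`,
  `comp_smul_val_mem_reflexCMType_iff`, `comp_coe_conjGal_smul`);
* `inducedCMType_reflexCMType_conjugate_left` — consequently, for ANY inclusion `e'` of `K*(σ̄, Θ)` into a field `M`, the
  induced type `inducedCMType e' (reflexCMType σ̄ Θ φ)` is `inducedCMType e (reflexCMType σ Θ φ)` with `e := e'` read on
  `K*(σ, Θ)`; so under a pin along `ῑ₁ = conj ∘ ι₁` (package «P2′» of the pinning lane; σ-parametric junction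
  `Transposition/Item6PinMatchAlong.lean`, p300221) ALL the conjugation of the CM side sits in the compatibility condition
  `(e k : ℂ) = σ k` imposed on the inclusion binder (at `σ := ῑ₁` it reads `(e k : ℂ) = conj (ι₁ k)` on the SAME field
  `K*(ι₁, Θ)`), none in the selected type `Φ_μ = Φ^{*ι₁}`, none in `K*`, none in the reflex type.

References: [Shimura1998] §8.3 Prop. 28 (reflex field and type); [Liu2021] Rem. 4.4 (TeX ll. 1930–1933: `M'_{μ^c} = M'_μ`,
`Ψ_{μ^c}` the opposite type).  No `sorry`, no new axiom, no definition, no named fact; axioms `propext`, `Classical.choice`,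
`Quot.sound`.  T5: n/a (no hypothesis binders).
-/

noncomputable section

namespace Summit.HodgeConjecture.CorCM

namespace Transposition

open Literature.AlgebraicGeometry.Motives (CMType)
open NumberField NumberField.ComplexEmbedding
open Literature.NumberTheory.ComplexMultiplication
open Literature.NumberTheory.ComplexMultiplication.CMTypeOps

variable {F : CMField} [IsGalois ℚ F]

/-- **The reflex CM type does not see the conjugation of the base embedding**: the reflex CM type of `Θ` read
through `σ̄` is the reflex CM type read through `σ`, transported along the identification of reflex fields
`K*(σ̄, Θ) = K*(σ, Θ)` (`reflexField_algValuedIn_conjugate_left`).  For `g ∈ Gal(F/ℚ)`: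
`σ̄ ∘ g|_{K*} ∈ Θ*_{σ̄} ↔ g ∈ S*(Θ_{σ̄}) = S*(Θ̄_σ) = ρ • S*(Θ_σ) ↔ ρ g ∈ S*(Θ_σ) ↔ σ ∘ (ρ g)|_{K*} = σ̄ ∘ g|_{K*} ∈ Θ*_σ`.
[cite: Shimura1998, §8.3 Prop. 28] -/
theorem reflexCMType_conjugate_left {K : Type*} [Field K] [Algebra ℚ K] (σ : F →+* ℂ) (Θ : CMType K) (φ : K →ₐ[ℚ] F) :
    reflexCMType (conjugate σ) Θ φ =
      inducedCMType
        ((IntermediateField.equivOfEq (reflexField_algValuedIn_conjugate_left σ Θ).symm :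
            reflexField ℚ F (algValuedIn σ Θ.1) ≃ₐ[ℚ] reflexField ℚ F (algValuedIn (conjugate σ) Θ.1)) :
          reflexField ℚ F (algValuedIn σ Θ.1) →+* reflexField ℚ F (algValuedIn (conjugate σ) Θ.1))
        (reflexCMType σ Θ φ) := by
  apply Subtype.ext
  ext τ
  obtain ⟨ψ, rfl⟩ :=
    exists_algHom_comp_eq_of_normal (reflexField ℚ F (algValuedIn (conjugate σ) Θ.1)).val (conjugate σ) τ
  obtain ⟨g, rfl⟩ := exists_algEquiv_smul_eq (reflexField ℚ F (algValuedIn (conjugate σ) Θ.1)).val ψ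
  have hinv : (conjGal : F ≃ₐ[ℚ] F)⁻¹ = conjGal := inv_eq_of_mul_eq_one_right conjGal_mul_conjGal
  rw [comp_smul_val_mem_reflexCMType_iff, mem_inducedCMType_iff, RingHom.comp_assoc,
    coe_smul_val_comp_coe_equivOfEq, ← conjugate_comp_ringHom, ← comp_coe_conjGal_smul, ← mul_smul,
    comp_smul_val_mem_reflexCMType_iff, algValuedIn_conjugate_left, reflexLift_algValuedIn_bar_eq_smul,
    Set.mem_smul_set_iff_inv_smul_mem, smul_eq_mul, hinv]

/-- The same with the `starRingEnd` spelling of `σ̄`. [cite: Shimura1998, §8.3 Prop. 28] -/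
theorem reflexCMType_starRingEnd_comp {K : Type*} [Field K] [Algebra ℚ K] (σ : F →+* ℂ) (Θ : CMType K)
    (φ : K →ₐ[ℚ] F) :
    reflexCMType ((starRingEnd ℂ).comp σ) Θ φ =
      inducedCMType
        ((IntermediateField.equivOfEq (reflexField_algValuedIn_conjugate_left σ Θ).symm :
            reflexField ℚ F (algValuedIn σ Θ.1) ≃ₐ[ℚ] reflexField ℚ F (algValuedIn (conjugate σ) Θ.1)) :
          reflexField ℚ F (algValuedIn σ Θ.1) →+* reflexField ℚ F (algValuedIn (conjugate σ) Θ.1))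
        (reflexCMType σ Θ φ) :=
  reflexCMType_conjugate_left σ Θ φ

/-- **All the conjugation sits in the inclusion**: for any ring map `e'` out of `K*(σ̄, Θ)` (e.g. the inclusion binder of
the σ-parametric pinning junction at `σ := ῑ₁`, with its compatibility `(e' k : ℂ) = σ̄ k`), the type induced from the
reflex CM type through `σ̄` is the type induced, along `e'` read on `K*(σ, Θ)`, from the reflex CM type through `σ`
(`reflexCMType_conjugate_left` + tree `inducedCMType_comp`). [cite: Shimura1998, §8.3 Prop. 28] -/
theorem inducedCMType_reflexCMType_conjugate_left {K : Type*} [Field K] [Algebra ℚ K] {M : Type*} [Field M]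
    (σ : F →+* ℂ) (Θ : CMType K) (φ : K →ₐ[ℚ] F) (e' : reflexField ℚ F (algValuedIn (conjugate σ) Θ.1) →+* M) :
    inducedCMType e' (reflexCMType (conjugate σ) Θ φ) =
      inducedCMType
        (e'.comp ((IntermediateField.equivOfEq (reflexField_algValuedIn_conjugate_left σ Θ).symm :
            reflexField ℚ F (algValuedIn σ Θ.1) ≃ₐ[ℚ] reflexField ℚ F (algValuedIn (conjugate σ) Θ.1)) :
          reflexField ℚ F (algValuedIn σ Θ.1) →+* reflexField ℚ F (algValuedIn (conjugate σ) Θ.1)))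
        (reflexCMType σ Θ φ) := by
  rw [reflexCMType_conjugate_left, ← inducedCMType_comp]

/-! ### Binder currency: an `hμ`-shaped family at `ι₁` is an `hμσ`-shaped family at `σ := conj ∘ ι₁` -/

omit [IsGalois ℚ F] in
/-- **`hμ ⟺ hμσ` at the conjugate pin.**  For any assignment `T` of a CM type of `F` to a face context `(F, ι₁, V, Φ)` (e.g.
the datum's `(D F ι₁ V Φ).cmType` of `Transposition/Item6PinMatch.lean` / `Item6PinMatchAlong.lean`), the family of
type-selection hypotheses of the shape of `hμσ` (`Item6PinMatchAlong.lean`:89–91) at the pin embedding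
`σ F ι₁ V Φ := (starRingEnd ℂ).comp ι₁ = ῑ₁` is EQUIVALENT to the family of the shape of `hμ` (`Item6PinMatch.lean`:195/:349:
`ι₁ ∘ g ∈ T ↔ ι₁ ∘ g⁻¹ ∈ Φ`) — guard prefix and binder order exactly as printed there (`isInverse_starRingEnd_comp_iff`
pointwise). [folklore] -/
theorem isInverse_family_starRingEnd_comp_iff
    (T : ∀ (F : CMField) (ι₁ : F →+* ℂ), HermSpace3 F ι₁ → CMType F → CMType F) :
    (∀ (F : CMField), IsGalois ℚ F → 6 ≤ Module.finrank ℚ F → ∀ (Φ : CMType F) (ι₁ : F →+* ℂ), ι₁ ∈ Φ.1 →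
        ∀ (V : HermSpace3 F ι₁) (g : F ≃ₐ[ℚ] F),
          ((starRingEnd ℂ).comp ι₁).comp (g : F →+* F) ∈ (T F ι₁ V Φ).1 ↔
            ((starRingEnd ℂ).comp ι₁).comp (g.symm : F →+* F) ∈ Φ.1) ↔
      (∀ (F : CMField), IsGalois ℚ F → 6 ≤ Module.finrank ℚ F → ∀ (Φ : CMType F) (ι₁ : F →+* ℂ), ι₁ ∈ Φ.1 →
        ∀ (V : HermSpace3 F ι₁) (g : F ≃ₐ[ℚ] F),
          ι₁.comp (g : F →+* F) ∈ (T F ι₁ V Φ).1 ↔ ι₁.comp (g.symm : F →+* F) ∈ Φ.1) := by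
  refine ⟨fun h F hG h6 Φ ι₁ hι V => ?_, fun h F hG h6 Φ ι₁ hι V => ?_⟩
  · haveI := hG
    exact (isInverse_starRingEnd_comp_iff ι₁ Φ (T F ι₁ V Φ)).mp (h F hG h6 Φ ι₁ hι V)
  · haveI := hG
    exact (isInverse_starRingEnd_comp_iff ι₁ Φ (T F ι₁ V Φ)).mpr (h F hG h6 Φ ι₁ hι V)

end Transposition

end Summit.HodgeConjecture.CorCM

end
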